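import Summits.ResolutionOfSingularities.ResolutionOfSingularities.Theorems.PurelyInseparableDim4Perm2BoundTranslated
import Mathlib.Algebra.CharP.Lemmas
import HarnessLib

/-!
# [OURS · res-dim4-pi PR-2, part 4] The translated PERM2-0 bound `d′ ≤ 2d − g + p^{e−1}` is SHARP
  for every prime `p` and every exponent, and what an excess over `2d − g` forces

Cell `res-dim4-pi` (D-0157 DOOR 2), lineage **PR-2** (seat `res-dim4-p-2`, generation 2), part 4 of the
series `…Perm2BoundOrigin` (p646720) · `…Perm2Bound` (p647736) · `…Perm2BoundTranslated` (p648595).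
Notation of parts 1–3: a state `(F, r, exc)` of the tree's coordinate-centre walk (`CentreBlowup.CState`,
`F` clean, `x^r ∣ F`), `d = ord₀ F − |r|` the shade, a coordinate centre `V(z, x_S)` under Hauser–Perlega's
condition (1) ONLY (`q ≤ ord_{(x_S)} F`), chart `j ∈ S`, a point `b` of the `x_j`-chart OVER THE ORIGIN
of the centre (`b_j = 0`, `b_i = 0` off `S`; the coordinates `x_i`, `i ∈ S ∖ j`, with `b_i ≠ 0` are
LOST), `g = ord_{(x_S)} F − Σ_{i∈S} r_i ≤ d`. Part 3 proved, at `q = p^e`: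
`d′ + g ≤ 2d + p^{e−1}` (`Perm2Bound.shade_step_add_le_two_mul_add_pow`), by a TRANSFER
`d′_S + g ≤ d′_point + d` to the point blow-up with the same chart and point, followed by Moh's bound.

## What is proved here

§1 **What an excess over the origin bound forces.** If `d′ + g > 2d` (the edge rises above part 2's
origin law `2d − g`, which is attained only through the `+p^{e−1}` of part 3), then the POINT step at the
same chart and point raises the shade (`pointStep_shadeIncreases_of_two_mul_lt`, every `q`), hence — by the
tree's fixed-coordinate reading of Hauser–Perlega's characterisation of the increase
(`PointBlowup.necessary_of_shadeIncreases_pow`, `exists_two_lost_of_shadeIncreases`,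
`residueInequality_of_shadeIncreases_of_clean`) — `q ∣ ord₀ F`, every kept or non-exceptional
variable `x_i` (`i ≠ j`) occurs in the initial form only with `q`-divisible exponents, some LOST
EXCEPTIONAL coordinate `x_i` (`i ∈ S ∖ j`, `b_i ≠ 0`, `r_i ≠ 0`) carries an initial exponent not
divisible by `q` and one with `q ∤ r_i`, and the residue inequality (6) holds on the lost set
(`necessary_of_two_mul_lt`). Corollaries: `q ∤ ord₀ F ⇒ d′ + g ≤ 2d`; «every lost exceptional
coordinate has `q ∣ r_i`» ⇒ `d′ + g ≤ 2d` (part 3's loss-free theorem is the vacuous case).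

§2 **Sharpness, every `p`, every exponent `e + 1`** (`q = p^{e+1}`, `m = pᵉ`, `n = q − m`). The state

  `F = x₂ⁿ·x₄ᵐ·(x₂ − x₄ + x₁x₃)^q = x₂^{q+n}x₄ᵐ − x₂ⁿx₄^{q+m} + x₁^q x₂ⁿ x₃^q x₄ᵐ`, `r = (0, n, 0, m)`, `exc = {x₂, x₄}`

(`ord₀ F = 2q`, `d = q`) has the plane `V(z, x₂, x₄)` as a Hironaka-permissible centre with
`ord_{(x₂,x₄)} F = q` EXACTLY (`g = 0 < d`: condition (2) fails, eclass C0) and NO permissible coordinate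
hyperplane (so the plane is a MODE-1h centre of record); at the point `x₄ = 1` of the `x₂`-chart the
transform is `(x₄ + 1)^m·(x₁x₃ − x₂x₄)^q = (x₄^m + 1)(x₁^q x₃^q − x₂^q x₄^q)` (freshman's dream twice), the
cleaning deletes the two `q`-th powers, the component `x₄` is lost and `x₂` gets multiplicity `q − q = 0`:
`F′ = x₄ᵐ(x₁^q x₃^q − x₂^q x₄^q)`, `r′ = 0`, `d′ = 2q + m = 2d − g + p^{(e+1)−1}` — EQUALITY in part 3's
bound (`translatedBound_attained_of_eq`, `translatedBound_attained`), a MODE-1h RISE:d by `q + pᵉ`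
(`exists_step1h_shade_eq_two_mul_add_pow`). At `e + 1 = 1` (the class of record) the rise is `p ↦ 2p + 1`;
for `p = 2` this is LITERALLY the census specimen J-005 «C0-T (+3)» of crit-3 BANK-A3-01, certified by
`decide` in `…ZooCertJ005` (p651175, `ZooCert.J005.a/k`: `x₂x₄³ + x₂³x₄ + x₁²x₂x₃²x₄ ↦ x₂²x₄³ + x₁²x₃²x₄`,
shade `2 ↦ 5`) — not restated here; this file is its all-`p`, all-`e` family, proved symbolically.
MECHANISM (crit-3's reading of J-005, now a theorem for all `p`, `e`): `G = w^q` with `w = ℓ + x₁x₃`,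
`ℓ = x₂ − x₄ ∈ (x₂, x₄)` the ideal of the centre; at the fibre point `ℓ ∘ π = x₂x₄ ∈ 𝔪²`, so `w ∘ π` has
order `2`, the credit `|r| = q` evaporates (both components gone: `x₄` translated, `x₂` re-read with
multiplicity `ord_S F − q = 0`), and the cleaning adds `pᵉ` through the factor `(x₄ + 1)^{pᵉ} = x₄^{pᵉ} + 1`
(the boundary case of Moh's bound at the point step: compare `PointBlowup.mohBound_attained`, whose
multiplicities `(pᵉ(p−1), pᵉ(p+1))` have the same residues).

## What is NOT proved (honest scope)
No «attained iff»: §1 gives necessary conditions for ANY excess over `2d − g`, §2 one family attaining the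
full `+p^{e−1}`; the excesses `+1 … +p^{e−1} − 1` are not classified. Points moving ALONG the centre are
brick PR-1 (`…MohAlong*`). [OURS · counted 0 · AI work weaker than expert review] NOTHING here proves
resolution of singularities in dimension ≥ 4 / characteristic `p`: these are exact laws of the letter `d`
of OUR candidate frame (MODE 1h coordinate game) — census value (the BANK LAW of crit-3 BANK-A3-01 at
translated points is optimal for every `p`, `e`). bears_on: LADDER-RESOLUTION:D157-DOOR2 (res-dim4-pi · PR-2).
Supports stmt-ResolutionOfSingularities-16155 (helper).
-/

noncomputable section

set_option linter.dupNamespace false -- mandated namespace of this single-conjunct summit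
open MvPolynomial Finset
open scoped BigOperators

namespace Summit.ResolutionOfSingularities.ResolutionOfSingularities.Theorems.PIDim4
namespace Perm2Bound
open Literature.AlgebraicGeometry.Resolution
open Literature.AlgebraicGeometry.Resolution.CentreBlowup
open Literature.AlgebraicGeometry.Resolution.Hauser2010

/-! ### §1 What an excess over the origin bound `2d − g` forces at a translated point -/

section Necessary
variable {σ : Type*} {K : Type*} [Field K] [Fintype σ] [DecidableEq σ] [DecidableEq K]

/-- **An excess over the origin bound is a shade increase of the point step** (every `q`): under
condition (1), `x^r ∣ F`, `ord_{(x_S)} F = Σ_{i∈S} r_i + g`, at a point over the origin of the centre,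
`2d < d′ + g` forces the POINT blow-up with the same chart and point to raise the shade (`d < d′_point`),
by part 3's transfer `d′ + g ≤ d′_point + d`. [folklore] -/
theorem pointStep_shadeIncreases_of_two_mul_lt {q : ℕ} {S : Finset σ} {j : σ} (hj : j ∈ S)
    (b : σ → K) (hbj : b j = 0) (hbN : ∀ i, i ∉ S → b i = 0) (s : CState σ K) {o : ℕ}
    (ho : ordZero s.F = o) (hr : ∀ d ∈ s.F.support, s.r ≤ d)
    (hq : ∀ d ∈ s.F.support, q ≤ degIn S d) {g : ℕ}
    (hg : ordAlong S s.F = ((degIn S s.r + g : ℕ) : ℕ∞))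
    (hex : 2 * s.shade < (step q S j b s).shade + (g : ℕ∞)) :
    PointBlowup.ShadeIncreases q j b s.toState := by
  have hT := shade_step_add_le_shade_pointStep_add hj b hbj hbN s ho hr hq hg
  unfold PointBlowup.ShadeIncreases
  by_contra hle
  rw [not_lt] at hle
  have hs : s.toState.shade = s.shade := rfl
  rw [hs] at hle
  have h2 : (step q S j b s).shade + (g : ℕ∞) ≤ 2 * s.shade :=
    le_trans hT (by rw [two_mul]; exact add_le_add hle le_rfl)
  exact absurd (lt_of_lt_of_le hex h2) (lt_irrefl _)

variable (p : ℕ) [hp : Fact p.Prime] [CharP K p]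

/-- **What an excess `d′ + g > 2d` forces** (`q = p^e`, `e ≥ 1`, clean `F`, `x^r ∣ F`, condition (1),
point over the origin of the centre) — Hauser–Perlega's characterisation of the increase, read in fixed
coordinates for the point step with the same chart and point: (i) `q ∣ ord₀ F` [(2)]; (ii) every variable
`x_i`, `i ≠ j`, that is kept (`b_i = 0`) or non-exceptional (`r_i = 0`) occurs in the initial form of `F`
only with `q`-divisible exponents [(7)]; (iii) some LOST EXCEPTIONAL coordinate of the centre (`i ∈ S ∖ j`,
`b_i ≠ 0`, `r_i ≠ 0`) carries an initial exponent not divisible by `q`; (iv) some lost coordinate of the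
centre has `q ∤ r_i` [Comment (d)]; (v) the residue inequality (6) on the lost set `{j} ∪ {i : b_i ≠ 0}`.
[cite: HauserPerlega2019PRIMS, §3 Theorem (2), (6), (7) and Comment (d)] -/
theorem necessary_of_two_mul_lt {e : ℕ} (he : 1 ≤ e) {S : Finset σ} {j : σ} (hj : j ∈ S)
    (b : σ → K) (hbj : b j = 0) (hbN : ∀ i, i ∉ S → b i = 0) (s : CState σ K)
    (hclean : deletePthPowers (p ^ e) s.F = s.F) {o : ℕ} (ho : ordZero s.F = o)
    (hr : ∀ d ∈ s.F.support, s.r ≤ d) (hq : ∀ d ∈ s.F.support, p ^ e ≤ degIn S d) {g : ℕ}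
    (hg : ordAlong S s.F = ((degIn S s.r + g : ℕ) : ℕ∞))
    (hex : 2 * s.shade < (step (p ^ e) S j b s).shade + (g : ℕ∞)) :
    p ^ e ∣ o ∧
    (∀ i, i ≠ j → (b i = 0 ∨ s.r i = 0) → ∀ d ∈ s.F.support, d.degree = o → p ^ e ∣ d i) ∧
    (∃ i ∈ S, i ≠ j ∧ b i ≠ 0 ∧ s.r i ≠ 0 ∧ ∃ d ∈ s.F.support, d.degree = o ∧ ¬ p ^ e ∣ d i) ∧
    (∃ i ∈ S, i ≠ j ∧ b i ≠ 0 ∧ ¬ p ^ e ∣ s.r i) ∧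
    HauserPerlega2019.ResidueInequality p (e - 1) (PointBlowup.lostComponents j b) s.r := by
  have hinc := pointStep_shadeIncreases_of_two_mul_lt hj b hbj hbN s ho hr hq hg hex
  have hqo : p ^ e ≤ o := by
    obtain ⟨⟨d₀, hd₀, hd₀deg⟩, -⟩ := (ordZero_eq_nat_iff _ _).mp ho
    have h1 := hq d₀ (MvPolynomial.mem_support_iff.mpr hd₀)
    have h2 := degIn_le_degree S d₀
    omega
  obtain ⟨h1, h2, i, hij, hbi, hri, d, hd, hddeg, hndvd⟩ :=
    PointBlowup.necessary_of_shadeIncreases_pow p j b hbj s.toState hclean ho hqo hr hinc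
  have hiS : i ∈ S := by
    by_contra h
    exact hbi (hbN i h)
  obtain ⟨i₁, i₂, hne, h₁, h₂, hr₁, hr₂⟩ :=
    PointBlowup.exists_two_lost_of_shadeIncreases p he j b hbj s.toState hclean ho hqo hr hinc
  have hR := PointBlowup.residueInequality_of_shadeIncreases_of_clean p he j b hbj s.toState hclean
    ho hqo hr hinc
  refine ⟨h1, h2, ⟨i, hiS, hij, hbi, hri, d, hd, hddeg, hndvd⟩, ?_, hR⟩
  by_cases hi1 : i₁ = j
  · have hi2 : i₂ ≠ j := fun h => hne (hi1.trans h.symm)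
    have hb2 : b i₂ ≠ 0 := h₂.resolve_left hi2
    exact ⟨i₂, by_contra fun h => hb2 (hbN i₂ h), hi2, hb2, hr₂⟩
  · have hb1 : b i₁ ≠ 0 := h₁.resolve_left hi1
    exact ⟨i₁, by_contra fun h => hb1 (hbN i₁ h), hi1, hb1, hr₁⟩

/-- **`q ∤ ord₀ F ⇒ d′ + g ≤ 2d` at every point over the origin** (`q = p^e`): without (2) for the
initial form there is no excess over the origin bound — in particular no `+p^{e−1}`.
[cite: HauserPerlega2019PRIMS, §3 Theorem (2)] -/
theorem shade_step_add_le_two_mul_of_not_dvd {e : ℕ} (he : 1 ≤ e) {S : Finset σ} {j : σ}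
    (hj : j ∈ S) (b : σ → K) (hbj : b j = 0) (hbN : ∀ i, i ∉ S → b i = 0) (s : CState σ K)
    (hclean : deletePthPowers (p ^ e) s.F = s.F) {o : ℕ} (ho : ordZero s.F = o)
    (hr : ∀ d ∈ s.F.support, s.r ≤ d) (hq : ∀ d ∈ s.F.support, p ^ e ≤ degIn S d) {g : ℕ}
    (hg : ordAlong S s.F = ((degIn S s.r + g : ℕ) : ℕ∞)) (hndvd : ¬ p ^ e ∣ o) :
    (step (p ^ e) S j b s).shade + (g : ℕ∞) ≤ 2 * s.shade := by
  by_contra hlt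
  rw [not_le] at hlt
  exact hndvd (necessary_of_two_mul_lt p he hj b hbj hbN s hclean ho hr hq hg hlt).1

/-- **Tame losses ⇒ `d′ + g ≤ 2d`**: if every LOST EXCEPTIONAL coordinate of the centre (`i ∈ S ∖ j`,
`b_i ≠ 0`, `r_i ≠ 0`) occurs in the initial form of `F` only with `q`-divisible exponents, there is no
excess over the origin bound (part 3's `shade_step_add_le_two_mul_of_lossFree` is the case of no lost
exceptional coordinate). [cite: HauserPerlega2019PRIMS, §3 Theorem (7) and Comment (d)] -/
theorem shade_step_add_le_two_mul_of_forall_lost {e : ℕ} (he : 1 ≤ e) {S : Finset σ} {j : σ}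
    (hj : j ∈ S) (b : σ → K) (hbj : b j = 0) (hbN : ∀ i, i ∉ S → b i = 0) (s : CState σ K)
    (hclean : deletePthPowers (p ^ e) s.F = s.F) {o : ℕ} (ho : ordZero s.F = o)
    (hr : ∀ d ∈ s.F.support, s.r ≤ d) (hq : ∀ d ∈ s.F.support, p ^ e ≤ degIn S d) {g : ℕ}
    (hg : ordAlong S s.F = ((degIn S s.r + g : ℕ) : ℕ∞))
    (htame : ∀ i ∈ S, i ≠ j → b i ≠ 0 → s.r i ≠ 0 →
      ∀ d ∈ s.F.support, d.degree = o → p ^ e ∣ d i) :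
    (step (p ^ e) S j b s).shade + (g : ℕ∞) ≤ 2 * s.shade := by
  by_contra hlt
  rw [not_le] at hlt
  obtain ⟨-, -, ⟨i, hiS, hij, hbi, hri, d, hd, hddeg, hndvd⟩, -, -⟩ :=
    necessary_of_two_mul_lt p he hj b hbj hbN s hclean ho hr hq hg hlt
  exact hndvd (htame i hiS hij hbi hri d hd hddeg)

/-- **`q ∣ r_i` at every lost coordinate ⇒ `d′ + g ≤ 2d`**: the multiplicity half of Comment (d) — an
excess needs a lost coordinate of the centre whose exceptional multiplicity is NOT divisible by `q`.
[cite: HauserPerlega2019PRIMS, §3 Theorem (6) and Comment (d)] -/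
theorem shade_step_add_le_two_mul_of_forall_lost_dvd {e : ℕ} (he : 1 ≤ e) {S : Finset σ} {j : σ}
    (hj : j ∈ S) (b : σ → K) (hbj : b j = 0) (hbN : ∀ i, i ∉ S → b i = 0) (s : CState σ K)
    (hclean : deletePthPowers (p ^ e) s.F = s.F) {o : ℕ} (ho : ordZero s.F = o)
    (hr : ∀ d ∈ s.F.support, s.r ≤ d) (hq : ∀ d ∈ s.F.support, p ^ e ≤ degIn S d) {g : ℕ}
    (hg : ordAlong S s.F = ((degIn S s.r + g : ℕ) : ℕ∞))
    (hdvd : ∀ i ∈ S, i ≠ j → b i ≠ 0 → p ^ e ∣ s.r i) :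
    (step (p ^ e) S j b s).shade + (g : ℕ∞) ≤ 2 * s.shade := by
  by_contra hlt
  rw [not_le] at hlt
  obtain ⟨-, -, -, ⟨i, hiS, hij, hbi, hndvd⟩, -⟩ :=
    necessary_of_two_mul_lt p he hj b hbj hbN s hclean ho hr hq hg hlt
  exact hndvd (hdvd i hiS hij hbi)

end Necessary

end Perm2Bound

end Summit.ResolutionOfSingularities.ResolutionOfSingularities.Theorems.PIDim4

end
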